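import Summits.HubbardSuperconductivity.HubbardSuperconductivity.Theorems.JosephsonMirrorGlue
import Literature.Barriers.HubbardSuperconductivity.PureModelStripeCompetition
import Literature.MathematicalPhysics.QuantumLattice.SectorEigenvalueContinuation
import Literature.MathematicalPhysics.QuantumLattice.PairFieldMomentum

/-!
# Crux `JmPairBridge` (stmt-HubbardSuperconductivity-2226), line `Sketch` — the floor-free bridge is the summit matrix

Route `JosephsonMirror`, crux `JmPairBridge` = thesis X: eventually in even `L`, every unit ground state `φ`
of `hubbardTorus 2 L 1 U` in `(N_L, S^z = 0)` has a unit GROUND STATE `χ` of `(N_L − 2, 0)` with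
`a L⁴ ≤ |⟨χ, Δ_d φ⟩|²` (`Δ_d = pairField dWaveFormFactor L`, `N_L = 2⌊(1-δ)L²/2⌋`).

This helper of line `Sketch` records, as a theorem, WHERE the crux exceeds what the route's deciding theorem
consumes (`closes (hX : JmPairBridge) (hXS : JmTargetToSummit)`; `jmTargetToSummit_proof` never uses that
`χ` is a ground state): drop the ground-state requirement on `χ` and the bridge becomes EQUIVALENT to the
summit matrix at the point,

* `weakBridge_iff_hasDWavePairFieldLROAt` (`δ ≥ 0`): (∃ a > 0, eventually in even `L`, every unit ground
  state `φ` of `(N_L, 0)` has SOME unit vector `χ` with `a L⁴ ≤ |⟨χ, Δ_d φ⟩|²`) `↔ HasDWavePairFieldLROAt U δ`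
  (`→`: Cauchy–Schwarz `|⟨χ, Δ_dφ⟩|² ≤ ‖Δ_dφ‖²` and the even-side bookkeeping
  `summitMatrix_of_everyGSOrder`; `←`: the uniform floor `everyGSOrder_of_summitMatrix` and
  `χ = Δ_dφ/‖Δ_dφ‖`, for which `|⟨χ, Δ_dφ⟩|² = ‖Δ_dφ‖²`);
* `summit_of_weakBridge`: the floor-free bridge at some `U > 0`, `δ ∈ (0, 1/2)` gives the summit.

So the residue of X over S is exactly the FLOOR requirement on `χ` (ground floor of `(N_L − 2, 0)`), which
line `Sketch` buys with the sector gap (`stub_pairBridgeAt_of_floors`) and places within `O(L⁻²)` of the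
floor without it (`windowedBridge_of_lroFloor_of_convexity`). Folklore bookkeeping (Scalapino, Phys. Rep.
250 (1995) 329, §2; C. N. Yang, Rev. Mod. Phys. 34 (1962) 694, §4; Tasaki (2020) §2.1). No definition, no
named fact.
-/

noncomputable section

-- the mandated namespace `Summit.<Summit>.<Problem>.Theorems` repeats `HubbardSuperconductivity`
-- (single-problem summit, D-0017), which the `dupNamespace` linter flags on every declaration
set_option linter.dupNamespace false

namespace Summit.HubbardSuperconductivity.HubbardSuperconductivity.Theorems.JosephsonMirror

open Matrix Literature.MathematicalPhysics.QuantumLattice Literature.Barriers.HubbardSuperconductivity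
open Summit.HubbardSuperconductivity.TwTipContinuation.Negative (summitMatrix_of_everyGSOrder
  everyGSOrder_of_summitMatrix)
open scoped ComplexOrder

/-- **The floor-free pair bridge at `(U, δ)` is the summit matrix at `(U, δ)`** (`δ ≥ 0`). Dropping
from thesis X the requirement that `χ` be a ground state of `(N_L − 2, 0)` leaves: `∃ a > 0`, eventually in
even `L`, every unit ground state `φ` of `(N_L, 0)` has some unit `χ` with `a L⁴ ≤ |⟨χ, Δ_d φ⟩|²`; this is
equivalent to `HasDWavePairFieldLROAt U δ`. `→`: `|⟨χ, Δ_dφ⟩|² ≤ ‖Δ_dφ‖² = Re⟨φ, Δ_dᴴΔ_d φ⟩`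
(Cauchy–Schwarz, `norm_sq_dotProduct_mulVec_le_expect`) and `summitMatrix_of_everyGSOrder`; `←`:
`everyGSOrder_of_summitMatrix` and `χ = Δ_dφ/‖Δ_dφ‖`. Scalapino (1995) §2; Yang (1962) §4. [folklore] -/
theorem weakBridge_iff_hasDWavePairFieldLROAt (U δ : ℝ) (hδ : 0 ≤ δ) :
    (∃ a : ℝ, 0 < a ∧ ∃ L₀ : ℕ, ∀ (L : ℕ) [NeZero L], Even L → L₀ ≤ L →
      ∀ φ : Fock (Orb (FermionTorus 2 L)),
        IsGroundStateInSector (hubbardTorus 2 L 1 U) (2 * ⌊(1 - δ) * (L : ℝ) ^ 2 / 2⌋₊) 0 φ →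
          star φ ⬝ᵥ φ = 1 →
            ∃ χ : Fock (Orb (FermionTorus 2 L)), star χ ⬝ᵥ χ = 1 ∧
              a * (L : ℝ) ^ 4 ≤ ‖star χ ⬝ᵥ Matrix.mulVec (pairField dWaveFormFactor L) φ‖ ^ 2) ↔
    HasDWavePairFieldLROAt U δ := by
  constructor
  · rintro ⟨a, ha, L₀, h⟩
    intro N ψ hadm
    refine summitMatrix_of_everyGSOrder ⟨a, ha, L₀, fun L _ hL₀ hE φ hφ1 hgs => ?_⟩ N ψ hadm
    obtain ⟨χ, hχ1, hle⟩ := h L hE hL₀ φ hgs hφ1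
    exact hle.trans (norm_sq_dotProduct_mulVec_le_expect _ hχ1 φ)
  · intro hS
    obtain ⟨c, hc, L₀, h⟩ := everyGSOrder_of_summitMatrix (U := U) (δ := δ) (by linarith) hS
    refine ⟨c, hc, L₀, fun L _ hE hL₀ φ hgs hφ1 => ?_⟩
    have hfloor := h L hL₀ hE φ hφ1 hgs
    set v := pairField dWaveFormFactor L *ᵥ φ with hv
    have hexp : (expect ((pairField dWaveFormFactor L)ᴴ * pairField dWaveFormFactor L) φ).re =
        (star v ⬝ᵥ v).re := by
      simp only [expect]
      rw [Literature.MathematicalPhysics.QuantumLattice.star_mulVec_dotProduct_mulVec]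
    rw [hexp] at hfloor
    have hLpos : (0 : ℝ) < (L : ℝ) := by exact_mod_cast Nat.pos_of_ne_zero (NeZero.ne L)
    have hSpos : 0 < (star v ⬝ᵥ v).re := lt_of_lt_of_le (by positivity) hfloor
    have hv0 : v ≠ 0 := by
      intro h0
      rw [h0, dotProduct_zero, Complex.zero_re] at hSpos
      exact lt_irrefl _ hSpos
    obtain ⟨r, hr0, hrr, hunit⟩ := EigenvalueContinuation.exists_normalize hv0
    refine ⟨(r : ℂ) • v, hunit, ?_⟩
    -- `⟨r v, v⟩ = r ‖v‖²`, `|r ‖v‖²|² = r²‖v‖⁴ = ‖v‖²`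
    have hov : star ((r : ℂ) • v) ⬝ᵥ Matrix.mulVec (pairField dWaveFormFactor L) φ =
        (r : ℂ) * (star v ⬝ᵥ v) := by
      rw [← hv, star_smul, smul_dotProduct, Complex.star_def, Complex.conj_ofReal, smul_eq_mul]
    have hvv : star v ⬝ᵥ v = ((star v ⬝ᵥ v).re : ℂ) := by
      rw [Complex.ext_iff]
      exact ⟨by simp, by simp [EigenvalueContinuation.im_star_dotProduct_self]⟩
    have hN : r * r * (star v ⬝ᵥ v).re = 1 := by
      have h1 := congrArg Complex.re hunit
      rw [EigenvalueContinuation.star_real_smul_dotProduct_real_smul, Complex.re_ofReal_mul,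
        Complex.one_re] at h1
      exact h1
    rw [hov, hvv, ← Complex.ofReal_mul, Complex.norm_real, Real.norm_eq_abs, sq_abs]
    have : (r * (star v ⬝ᵥ v).re) ^ 2 = (star v ⬝ᵥ v).re := by
      calc (r * (star v ⬝ᵥ v).re) ^ 2 = (r * r * (star v ⬝ᵥ v).re) * (star v ⬝ᵥ v).re := by ring
        _ = (star v ⬝ᵥ v).re := by rw [hN, one_mul]
    rw [this]
    exact hfloor

/-- **The floor-free bridge already gives the summit.** If at some `U > 0`, `δ ∈ (0, 1/2)`, eventually in
even `L`, every unit ground state `φ` of `(N_L, 0)` has some unit `χ` with `a L⁴ ≤ |⟨χ, Δ_d φ⟩|²`, then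
`HubbardSuperconductivity` holds — the same proof as the route's `jmTargetToSummit_proof`, which never uses
that `χ` is a ground state. Scalapino (1995) §2 eq. (2.4); Yang (1962) §4. [folklore] -/
theorem summit_of_weakBridge
    (h : ∃ U : ℝ, 0 < U ∧ ∃ δ ∈ Set.Ioo (0 : ℝ) (1 / 2),
      ∃ a : ℝ, 0 < a ∧ ∃ L₀ : ℕ, ∀ (L : ℕ) [NeZero L], Even L → L₀ ≤ L →
        ∀ φ : Fock (Orb (FermionTorus 2 L)),
          IsGroundStateInSector (hubbardTorus 2 L 1 U) (2 * ⌊(1 - δ) * (L : ℝ) ^ 2 / 2⌋₊) 0 φ →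
            star φ ⬝ᵥ φ = 1 →
              ∃ χ : Fock (Orb (FermionTorus 2 L)), star χ ⬝ᵥ χ = 1 ∧
                a * (L : ℝ) ^ 4 ≤ ‖star χ ⬝ᵥ Matrix.mulVec (pairField dWaveFormFactor L) φ‖ ^ 2) :
    _root_.HubbardSuperconductivity := by
  obtain ⟨U, hU, δ, hδ, hweak⟩ := h
  unfold _root_.HubbardSuperconductivity Literature.Hubbard.DWaveSuperconductivityHubbard
  exact ⟨U, hU, δ, hδ, (weakBridge_iff_hasDWavePairFieldLROAt U δ hδ.1.le).1 hweak⟩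

end Summit.HubbardSuperconductivity.HubbardSuperconductivity.Theorems.JosephsonMirror

end
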